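import Summits.QuantumFields.QCD.Theorems.ExtinctionBuildsQCD.Negative.CrossingBudget

/-!
# Negative knowledge for crux `ExtinctionBuildsQCD` (stmt-QuantumFields-8968), §5: the index budget —
# jumps of the spectral index of `Γ₅ D_W(U, μ, 1)` are real modes of `D_W(U, 0, 1)`

Certified copy of §5 (Wilson part) of the cdisprove work file
`Summits/QuantumFields/QCD/Cruxes/ExtinctionBuildsQCD/Disproof.lean` (refuter, cdisprove seat, cycle 2).
Supports stmt-QuantumFields-8968; asserts no route item. Proves the lemma typed as the stub
`negCount_sub_le_realBandCount` in `Cruxes/ExtinctionBuildsQCD/Sketch-ideator3.lean` (card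
`tight-two-sided-pin`) and its TIGHT-budget corollaries, for EVERY gauge field (no measure theory).

* Matrix part (files `InertiaPencil.lean`, `CrossingBudget.lean`, imported). `negRootCount_local`: along an affine Hermitian pencil
  `H(t) = A + tΓ` with `|Re⟨v, Γv⟩| ≤ ‖v‖²`, near every `s` one has
  `n₋(H s) ≤ n₋(H t) ≤ n₋(H s) + n₀(H s)` (Sylvester's law of inertia applied to the negative and the
  positive eigenspaces of `H(s)` — `card_le_card_eigenvalues_of_form_pos` of `ChiralInertia.lean`; no
  eigenvalue perturbation theory). `zeroRootCount_le_count`: with `Γ² = 1`,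
  `n₀(A + sΓ) ≤ mult_{-s} charpoly(ΓA)` (rank-nullity and geometric ≤ algebraic multiplicity,
  Mathlib `LinearMap.finrank_eigenspace_le`). `abs_sub_le_countP_of_local_jumps`: an ℕ-valued function
  of a real variable that locally cannot drop and can rise by at most `z(s) ≤ #_R(s)` for a finite
  multiset `R` varies over `[a, b]` by at most `#(R ∩ [a,b])` (locally constant off `R` ⇒ constant on
  root-free intervals by connectedness of intervals; roots crossed one at a time, endpoints paid once).
  Together: `abs_negRootCount_sub_le_countP_real`,
  `|n₋(A + bΓ) - n₋(A + aΓ)| ≤ #{real eigenvalues of ΓA in [-b, -a]}`.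
* Wilson part (`Γ = Γ₅`, `A = Γ₅ D_W(U,0,1)`, `Γ₅ D_W(U,μ,1) = A + μΓ₅`):
  `abs_negCount_hermitianWilson_sub_le` — for all `a ≤ b` and every `SU(3)` field,
  `|n₋(Γ₅D_W(U,b,1)) - n₋(Γ₅D_W(U,a,1))| ≤ #{real λ ∈ spec D_W(U,0,1) : -b ≤ λ ≤ -a}`;
  with chiral inertia at `b = 1` (`negCount_hermitianWilson_eq`): `abs_index_le_realModeCount` —
  `|n₋(Γ₅D_W(U,p,1)) - 6L⁴| ≤ #{real λ ≤ -p}` for EVERY probe `p`; hence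
  `tight_integrand_le_signDefects_add_band` (TIGHT integrand ≤ EXTINCT sign-defect count + number of
  real modes in the band `[-(m_crit+w_f), -(m_crit-w_M)]` at the line) and
  `index_eq_zero_of_no_realMode` (no real mode in `[0,-p]` ⇒ index `0`).
  Reading for the crux: TIGHT (`E₊|index| ≥ 1`) can only be met by real modes of the massless Wilson
  operator inside `[0, a_k M/Z_k - m_crit(k)]` — at the TIP of the hole for a tip witness
  (`m_crit ≥ 0`, §4 `VolumeLever.lean`), in the band at the line for an honest one.

References: Edwards–Heller–Narayanan, Nucl. Phys. B 535 (1998) 403, §2 (spectral flow of `H_W(m)`: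
level crossings ↔ real eigenvalues of `D_W`, index = net crossings); Itoh–Iwasaki–Yoshié, Phys. Rev.
D 36 (1987) 527 (real modes of the Wilson operator and topology); Horn–Johnson, *Matrix Analysis*
(1985), Thm. 4.5.8 (Sylvester's law of inertia).
-/

noncomputable section

namespace Summit.QuantumFields.QCD.Theorems.ExtinctionBuildsQCD.Negative

open scoped BigOperators Topology Classical MeasureTheory Matrix ComplexConjugate
open Filter MeasureTheory Matrix
open Literature.MathematicalPhysics.QuantumLattice Literature.MathematicalPhysics.QuantumFieldTheory
  Literature.Probability.LatticeModels
open Summit.QuantumFields.QCD.Theses.SpectralDefectExtinction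

/-! ### The Wilson instance: index jumps of `Γ₅ D_W(U, μ, 1)` are real modes of `D_W(U, 0, 1)` -/

section IndexBudgetWilson

variable {L : ℕ} [NeZero L]

/-- The chirality form is bounded by the norm: `|Re⟨v, Γ₅ v⟩| ≤ Σ‖v‖²` (`Γ₅ = diag(±1)`). -/
theorem abs_re_form_gammaFive_le (v : QuarkIdx L → ℂ) :
    |(star v ⬝ᵥ (spinorLift (L := L) (N := 3) gammaFive *ᵥ v)).re| ≤ ∑ i, ‖v i‖ ^ 2 := by
  refine (Complex.abs_re_le_norm _).trans ?_
  rw [dotProduct]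
  refine (norm_sum_le _ _).trans (le_of_eq ?_)
  refine Finset.sum_congr rfl fun p _ => ?_
  rw [spinorLift_gammaFive_eq_diagonal, mulVec_diagonal, Pi.star_apply, norm_mul, norm_mul,
    Complex.star_def, Complex.norm_conj]
  have h1 : ‖(![1, 1, -1, -1] : Fin 4 → ℂ) p.2.2‖ = 1 := by
    rcases p with ⟨x, a, α⟩
    fin_cases α <;> simp
  rw [h1, one_mul, sq]

/-- `Γ₅ D_W(U, μ, 1) = Γ₅ D_W(U, 0, 1) + μ Γ₅`: the Hermitian Wilson operators form an affine pencil in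
the bare mass. -/
theorem gammaFive_mul_wilsonDirac_eq_add_smul (U : GaugeConfig 4 L SU3) (μ : ℝ) :
    spinorLift gammaFive * wilsonDirac (fundamentalRep (Fin 3)) U μ 1 =
      spinorLift gammaFive * wilsonDirac (fundamentalRep (Fin 3)) U 0 1 +
        ((μ : ℝ) : ℂ) • spinorLift (L := L) (N := 3) gammaFive := by
  rw [wilsonDirac_mass_eq_add_scalar (fundamentalRep (Fin 3)) U μ 1, mul_add, scalar_apply,
    ← smul_one_eq_diagonal, Matrix.mul_smul, mul_one]

/-- **Index jumps are real modes (crossing budget for the Hermitian Wilson family).** For every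
`SU(3)` gauge field and bare masses `a ≤ b`, the negative-eigenvalue counts of `Γ₅ D_W(U, b, 1)` and
`Γ₅ D_W(U, a, 1)` (roots of the characteristic polynomial with negative real part, with multiplicity —
the count inside TIGHT) differ by at most the number of REAL eigenvalues `λ` of the massless operator
`D_W(U, 0, 1)` with `-b ≤ λ ≤ -a`, counted with algebraic multiplicity: a level of the Hermitian family
crosses zero only where `D_W(U,0,1) + μ` is singular, and by at most its nullity (Sylvester on both
sides of the crossing; geometric ≤ algebraic multiplicity). This is the lemma typed as a stub
(`negCount_sub_le_realBandCount`) in `Cruxes/ExtinctionBuildsQCD/Sketch-ideator3.lean`. -/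
theorem abs_negCount_hermitianWilson_sub_le (U : GaugeConfig 4 L SU3) {a b : ℝ} (hab : a ≤ b) :
    |(Multiset.countP (fun z : ℂ => z.re < 0)
        (spinorLift gammaFive * wilsonDirac (fundamentalRep (Fin 3)) U b 1).charpoly.roots : ℤ) -
      Multiset.countP (fun z : ℂ => z.re < 0)
        (spinorLift gammaFive * wilsonDirac (fundamentalRep (Fin 3)) U a 1).charpoly.roots| ≤
      Multiset.countP (fun z : ℂ => z.im = 0 ∧ -b ≤ z.re ∧ z.re ≤ -a)
        (wilsonDirac (fundamentalRep (Fin 3)) U 0 1).charpoly.roots := by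
  set Γ : Matrix (QuarkIdx L) (QuarkIdx L) ℂ := spinorLift gammaFive with hΓ_def
  set D := wilsonDirac (fundamentalRep (Fin 3)) U 0 1 with hD
  have hA : (Γ * D).IsHermitian :=
    Literature.Barriers.QuantumFields.isHermitian_gammaFive_mul_wilsonDirac (fundamentalRep (Fin 3))
      fundamentalRep_mem_unitaryGroup U 0 1
  have hΓ : Γ.IsHermitian := conjTranspose_spinorLift_gammaFive'
  have hΓ2 : Γ * Γ = 1 := spinorLift_gammaFive_mul_self
  have hD' : Γ * (Γ * D) = D := by rw [← Matrix.mul_assoc, hΓ2, Matrix.one_mul]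
  have h := abs_negRootCount_sub_le_countP_real hA hΓ hΓ2 abs_re_form_gammaFive_le hab
  rw [hD'] at h
  simpa only [negRootCount, hΓ_def, hD, ← gammaFive_mul_wilsonDirac_eq_add_smul] using h

/-- **The TIGHT integrand is a count of real modes below the probe.** For every gauge field and
every probe mass `p`, `|n₋(Γ₅ D_W(U, p, 1)) - 6L⁴| ≤ #{real eigenvalues λ of D_W(U,0,1) with λ ≤ -p}`
(with multiplicity; all real eigenvalues are `≥ 0`, so this is the count in `[0, -p]`, empty for
`p > 0`). Chiral inertia at `b = 1` (`negCount_hermitianWilson_eq`) plus the crossing budget. In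
particular the spectral index at probe `p` vanishes unless the massless Wilson operator has a real
mode in `[0, -p]`: for a TIP witness (`m_crit(k) ≥ 0`, probe `-a_k M/Z_k + m_crit(k)`) TIGHT asks for
real modes within `a_k M/Z_k` of the tip of the Wilson hole, on average at least one per scheme torus;
for an honest witness (`m_crit(k) < 0`) see `tight_integrand_le_signDefects_add_band`. -/
theorem abs_index_le_realModeCount (U : GaugeConfig 4 L SU3) (p : ℝ) :
    |(Multiset.countP (fun z : ℂ => z.re < 0)
        (spinorLift gammaFive * wilsonDirac (fundamentalRep (Fin 3)) U p 1).charpoly.roots : ℤ) -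
      6 * (L : ℤ) ^ 4| ≤
      (Multiset.countP (fun z : ℂ => z.im = 0 ∧ z.re ≤ -p)
        (wilsonDirac (fundamentalRep (Fin 3)) U 0 1).charpoly.roots : ℤ) := by
  rcases le_or_gt p 0 with hp | hp
  · have h := abs_negCount_hermitianWilson_sub_le U (show p ≤ 1 by linarith)
    rw [negCount_hermitianWilson_eq (Or.inl one_pos) U] at h
    push_cast at h
    rw [abs_sub_comm] at h
    refine h.trans (le_of_eq ?_)
    congr 1
    refine Multiset.countP_congr rfl fun z hz => propext ⟨fun h => ⟨h.1, h.2.2⟩, fun h => ⟨h.1, ?_, h.2⟩⟩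
    have := (re_mem_Icc_of_real_root U hz h.1).1
    linarith
  · rw [negCount_hermitianWilson_eq (Or.inl hp) U]
    simp

/-- **TIGHT integrand ≤ sign defects + band modes (honest line).** For a line at `m_crit`, a flavour
window `w_f ≥ 0` (bare mass `m_crit + w_f`, `w_f = a_k m_f/Z_k`) and a probe `m_crit - w_M`, `w_M ≥ 0`:
`|n₋(Γ₅ D_W(U, m_crit - w_M, 1)) - 6L⁴| ≤ #{real λ < -(m_crit + w_f)} + #{real λ ∈ [-(m_crit + w_f), -(m_crit - w_M)]}`
— the EXTINCT sign-defect count of that flavour (verbatim the route's `countP`) plus the number of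
real modes of `D_W(U,0,1)` in the band of bare width `w_f + w_M` at the line. Integrated against the
phase-quenched weight this is the content of TIGHT ∧ EXTINCT(a): `E₊[band modes] ≥ 1 - E₊[sign defects]`
(cf. idea card `tight-two-sided-pin`; the integration needs measurability of the counts in `U`, not
done here). -/
theorem tight_integrand_le_signDefects_add_band (U : GaugeConfig 4 L SU3) (mcrit wf wM : ℝ)
    (hwf : 0 ≤ wf) (hwM : 0 ≤ wM) :
    |(Multiset.countP (fun z : ℂ => z.re < 0)
        (spinorLift gammaFive * wilsonDirac (fundamentalRep (Fin 3)) U (mcrit - wM) 1).charpoly.roots : ℤ) -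
      6 * (L : ℤ) ^ 4| ≤
      (Multiset.countP (fun z : ℂ => z.im = 0 ∧ z.re < -(mcrit + wf))
          (wilsonDirac (fundamentalRep (Fin 3)) U 0 1).charpoly.roots : ℤ) +
        (Multiset.countP (fun z : ℂ => z.im = 0 ∧ -(mcrit + wf) ≤ z.re ∧ z.re ≤ -(mcrit - wM))
          (wilsonDirac (fundamentalRep (Fin 3)) U 0 1).charpoly.roots : ℤ) := by
  refine (abs_index_le_realModeCount U (mcrit - wM)).trans (le_of_eq ?_)
  set R := (wilsonDirac (fundamentalRep (Fin 3)) U 0 1).charpoly.roots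
  rw [Multiset.countP_eq_countP_filter_add R (fun z : ℂ => z.im = 0 ∧ z.re ≤ -(mcrit - wM))
    (fun z : ℂ => z.re < -(mcrit + wf)), Multiset.countP_filter, Multiset.countP_filter]
  have e1 : Multiset.countP (fun z : ℂ => (z.im = 0 ∧ z.re ≤ -(mcrit - wM)) ∧ z.re < -(mcrit + wf)) R =
      Multiset.countP (fun z : ℂ => z.im = 0 ∧ z.re < -(mcrit + wf)) R := by
    refine Multiset.countP_congr rfl fun z _ => propext ⟨fun h => ⟨h.1.1, h.2⟩, fun h => ⟨⟨h.1, ?_⟩, h.2⟩⟩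
    linarith [h.2]
  have e2 : Multiset.countP (fun z : ℂ => (z.im = 0 ∧ z.re ≤ -(mcrit - wM)) ∧ ¬ z.re < -(mcrit + wf)) R =
      Multiset.countP (fun z : ℂ => z.im = 0 ∧ -(mcrit + wf) ≤ z.re ∧ z.re ≤ -(mcrit - wM)) R :=
    Multiset.countP_congr rfl fun z _ => propext
      ⟨fun h => ⟨h.1.1, not_lt.1 h.2, h.1.2⟩, fun h => ⟨⟨h.1, h.2.2⟩, not_lt.2 h.2.1⟩⟩
  rw [e1, e2]
  push_cast
  rfl

/-- **No real mode in `[0, -p]` ⇒ zero index at probe `p`** (configuration-wise). The spectral index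
that TIGHT integrates vanishes on every gauge field whose massless Wilson operator has no real
eigenvalue `≤ -p`; TIGHT therefore forces, eventually in `k` and for every `M > M₀`, a phase-quenched
probability `≥ (6(2L_k+1)⁴)⁻¹`-positive — indeed an expected count `≥ 1` — of real modes of
`D_W(U,0,1)` in `[0, a_k M/Z_k - m_crit(k)]` on the scheme torus (the tip when `m_crit ≥ 0`, the band at
the line when `m_crit < 0`). -/
theorem index_eq_zero_of_no_realMode (U : GaugeConfig 4 L SU3) {p : ℝ}
    (h0 : Multiset.countP (fun z : ℂ => z.im = 0 ∧ z.re ≤ -p)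
      (wilsonDirac (fundamentalRep (Fin 3)) U 0 1).charpoly.roots = 0) :
    Multiset.countP (fun z : ℂ => z.re < 0)
        (spinorLift gammaFive * wilsonDirac (fundamentalRep (Fin 3)) U p 1).charpoly.roots =
      6 * L ^ 4 := by
  have h := abs_index_le_realModeCount U p
  rw [h0, Nat.cast_zero] at h
  have h' := sub_eq_zero.1 (abs_nonpos_iff.1 h)
  exact_mod_cast h'

end IndexBudgetWilson

end Summit.QuantumFields.QCD.Theorems.ExtinctionBuildsQCD.Negative

end
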